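import Mathlib
import Literature.MathematicalPhysics.StatisticalMechanics.BarlowStacking
import Summits.AtomisticToContinuum.Crystallization.Theorems.BraggSlacknessRigidityHcpDiffractionRigidityEssentialPeriodicityRatAux6
import Summits.AtomisticToContinuum.Crystallization.Theorems.BraggSlacknessRigidityHcpDiffractionRigidityTemplateLatticeSplitAux3
import Summits.AtomisticToContinuum.Crystallization.Theorems.BraggSlacknessRigidityHcpDiffractionRigidityTemplateLatticeSplitAux4

/-!
# Template lattices are split (stub `stub_templateLatticeSplit` of crux `HcpDiffractionRigidity`,
# item `stmt-AtomisticToContinuum-13166`, B2c₁ᵦ)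

Let `h²/a² ∉ ℚ` and let `N ⊆ ℝ³` be a discrete `ℤ`-module spanning `ℝ³` all of whose vectors have
hcp-template lengths.  By Aux file 3 the Euclidean form on `N` splits as
`⟨z, z'⟩ = a² A(z,z') + h² λ(z) λ(z')` (`A` symmetric biadditive with in-layer diagonal values
`(I² + IJ + J²)/9`, hence `18 A ∈ ℤ`; `λ : N →+ ℤ` the layer index), and by Aux file 4 there is a
vertical period `v ∈ N`: `λ(v) = n₀ ≠ 0`, `|v|² = h² n₀²`, `v ⊥ K := ker λ`.  Since
`n₀ z − λ(z) v ∈ K` for every `z ∈ N`, the module `(1/k) N` lies in `M₂ ⊕ ℤ v'` with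
`M₂ := c K`, `v' := c v`, `c := 1/(k n₀)`; `M₂ ⊥ v'`, `D ⟨M₂, M₂⟩ ⊆ a² ℤ` and `D |v'|² ∈ h² ℤ`
for `D := 18 k² n₀²`; `M₂ ⊕ ℤ v' ⊇ N` spans `ℝ³`, and it is discrete because
`|c u + j c v|² = c² (|u|² + j² |v|²)` is bounded below by `c² min(r², |v|²)` (`r` the minimal norm
of `N`, `HcpRigiditySpectral.exists_pos_le_norm_of_discrete`).  This is `templateLatticeSplit`;
the registered stub `stub_templateLatticeSplit` follows.
All `[folklore]`.
-/

noncomputable section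

namespace Summit.AtomisticToContinuum.Crystallization.Theorems

namespace HcpRigiditySplit

open scoped BigOperators Real RealInnerProductSpace
open Literature.MathematicalPhysics.StatisticalMechanics

/-! ## Discreteness from a minimal norm -/

/-- A `ℤ`-submodule of `ℝ³` with a positive minimal norm is discrete (converse of
`HcpRigiditySpectral.exists_pos_le_norm_of_discrete`). [folklore] -/
theorem discreteTopology_of_le_norm (S : Submodule ℤ (EuclideanSpace ℝ (Fin 3))) {ρ : ℝ}
    (hρ : 0 < ρ) (h : ∀ x ∈ S, x ≠ 0 → ρ ≤ ‖x‖) : DiscreteTopology S := by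
  rw [discreteTopology_iff_isOpen_singleton]
  intro x
  rw [Metric.isOpen_singleton_iff]
  refine ⟨ρ, hρ, fun y hy => ?_⟩
  by_contra hne
  have h1 : (y : EuclideanSpace ℝ (Fin 3)) - x ∈ S := S.sub_mem y.2 x.2
  have h2 : (y : EuclideanSpace ℝ (Fin 3)) - x ≠ 0 := sub_ne_zero.2 fun h0 => hne (Subtype.ext h0)
  have h3 := h _ h1 h2
  rw [Subtype.dist_eq, dist_eq_norm] at hy
  linarith

/-! ## The splitting -/

/-- **Template lattices are split.** For the hcp template with `h²/a² ∉ ℚ`, a discrete full-rank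
`ℤ`-module `N ⊆ ℝ³` all of whose vectors have template lengths satisfies, for every `k ≥ 1`:
`(1/k) N ⊆ M₂ ⊕ ℤ v` for a discrete full-rank split module — `M₂ ⊥ v`, `D ⟨M₂, M₂⟩ ⊆ a² ℤ`,
`D |v|² ∈ h² ℤ`. [folklore] -/
theorem templateLatticeSplit {a h : ℝ} (ha : a ≠ 0) (hh : h ≠ 0)
    (hq : ¬ ∃ q : ℚ, h ^ 2 = (q : ℝ) * a ^ 2) {N : Submodule ℤ (EuclideanSpace ℝ (Fin 3))}
    (hNd : DiscreteTopology N)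
    (hNs : Submodule.span ℝ (N : Set (EuclideanSpace ℝ (Fin 3))) = ⊤)
    (hN : ∀ z ∈ N, ∃ a' ∈ (hcpPeriodicConfiguration ha hh).points,
      ∃ b' ∈ (hcpPeriodicConfiguration ha hh).points, ‖z‖ = dist a' b') {k : ℕ} (hk : 0 < k) :
    ∃ (M₂ : Submodule ℤ (EuclideanSpace ℝ (Fin 3))) (v : EuclideanSpace ℝ (Fin 3)) (D : ℕ),
      0 < D ∧ v ≠ 0 ∧ (∀ u ∈ M₂, ⟪u, v⟫ = 0) ∧
      (∀ u ∈ M₂, ∀ w ∈ M₂, ∃ n : ℤ, (D : ℝ) * ⟪u, w⟫ = (n : ℝ) * a ^ 2) ∧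
      (∃ n : ℤ, (D : ℝ) * ‖v‖ ^ 2 = (n : ℝ) * h ^ 2) ∧
      DiscreteTopology ↥(M₂ ⊔ Submodule.span ℤ {v}) ∧
      Submodule.span ℝ ((M₂ ⊔ Submodule.span ℤ {v} : Submodule ℤ (EuclideanSpace ℝ (Fin 3))) :
        Set (EuclideanSpace ℝ (Fin 3))) = ⊤ ∧
      ∀ p : (EuclideanSpace ℝ (Fin 3)), (k : ℤ) • p ∈ N → p ∈ M₂ ⊔ Submodule.span ℤ {v} := by
  obtain ⟨A, lam, hsymm, hinner, hval⟩ := exists_forms ha hq (normSq_decomp_of_template ha hh hN)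
  obtain ⟨v, hv, hvv, hperp⟩ := exists_layer_normal ha hNs hsymm hinner hval
  haveI := hNd
  obtain ⟨r, hr, hrN⟩ := HcpRigiditySpectral.exists_pos_le_norm_of_discrete N
  -- the scaling constant `c = 1/(k n₀)`
  set n₀ : ℤ := lam v with hn₀
  have hk0 : (k : ℝ) ≠ 0 := by exact_mod_cast hk.ne'
  have hn0 : (n₀ : ℝ) ≠ 0 := by exact_mod_cast hv
  set c : ℝ := ((k : ℝ) * n₀)⁻¹ with hc
  have hc0 : c ≠ 0 := inv_ne_zero (mul_ne_zero hk0 hn0)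
  have hckn : c * (n₀ : ℝ) * k = 1 := by rw [hc]; field_simp
  have hv0 : (v : EuclideanSpace ℝ (Fin 3)) ≠ 0 := fun h0 =>
    hv (by rw [hn₀, show v = 0 by exact_mod_cast h0, map_zero])
  have hvpos : 0 < ‖(v : EuclideanSpace ℝ (Fin 3))‖ := norm_pos_iff.2 hv0
  -- the in-layer module `M₂ = c • ker λ` and the vertical period `v' = c • v`
  set φ : N →ₗ[ℤ] EuclideanSpace ℝ (Fin 3) :=
    ((c • LinearMap.id : EuclideanSpace ℝ (Fin 3) →ₗ[ℝ] EuclideanSpace ℝ (Fin 3)).restrictScalars ℤ)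
      ∘ₗ N.subtype with hφ
  have hφapp : ∀ u : N, φ u = c • (u : EuclideanSpace ℝ (Fin 3)) := fun u => rfl
  set M₂ : Submodule ℤ (EuclideanSpace ℝ (Fin 3)) := (LinearMap.ker lam.toIntLinearMap).map φ
    with hM₂
  have hmem : ∀ x : EuclideanSpace ℝ (Fin 3),
      x ∈ M₂ ↔ ∃ u : N, lam u = 0 ∧ c • (u : EuclideanSpace ℝ (Fin 3)) = x := by
    intro x
    simp only [hM₂, Submodule.mem_map, LinearMap.mem_ker, AddMonoidHom.coe_toIntLinearMap, hφapp]
  set v' : EuclideanSpace ℝ (Fin 3) := c • (v : EuclideanSpace ℝ (Fin 3)) with hv'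
  set D : ℕ := 18 * k ^ 2 * n₀.natAbs ^ 2 with hD
  have hDR : (D : ℝ) = 18 * (k : ℝ) ^ 2 * (n₀ : ℝ) ^ 2 := by
    rw [hD, Nat.cast_mul, Nat.cast_mul, Nat.cast_pow, Nat.cast_pow, Nat.cast_natAbs, Int.cast_abs,
      sq_abs]
    norm_num
  have hDc : (D : ℝ) * (c * c) = 18 := by
    rw [hDR, hc]; field_simp
  -- the decomposition `p = c (n₀ z − λ(z) v) + λ(z) v'` of `p = z/k`, `z ∈ N`
  have hdec : ∀ (z : N) (p : EuclideanSpace ℝ (Fin 3)),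
      (z : EuclideanSpace ℝ (Fin 3)) = (k : ℤ) • p →
      p = c • ((n₀ • z - lam z • v : N) : EuclideanSpace ℝ (Fin 3)) + ((lam z : ℤ) : ℝ) • v' := by
    intro z p hzp
    rw [Submodule.coe_sub, Submodule.coe_smul, Submodule.coe_smul, hzp, hv',
      ← Int.cast_smul_eq_zsmul ℝ n₀, ← Int.cast_smul_eq_zsmul ℝ (lam z),
      ← Int.cast_smul_eq_zsmul ℝ (k : ℤ), Int.cast_natCast, smul_sub, smul_smul, smul_smul,
      smul_smul, smul_smul, hckn, one_smul, mul_comm c ((lam z : ℤ) : ℝ), sub_add_cancel]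
  have hmemk : ∀ p : EuclideanSpace ℝ (Fin 3), (k : ℤ) • p ∈ N →
      p ∈ M₂ ⊔ Submodule.span ℤ {v'} := by
    intro p hp
    set z : N := ⟨(k : ℤ) • p, hp⟩ with hz
    have hu : lam (n₀ • z - lam z • v) = 0 := by
      simp only [map_sub, map_zsmul, smul_eq_mul, hn₀]; ring
    rw [hdec z p rfl]
    refine Submodule.add_mem _ (Submodule.mem_sup_left ((hmem _).2 ⟨_, hu, rfl⟩))
      (Submodule.mem_sup_right ?_)
    rw [Int.cast_smul_eq_zsmul]
    exact Submodule.smul_mem _ _ (Submodule.mem_span_singleton_self v')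
  refine ⟨M₂, v', D, ?_, smul_ne_zero hc0 hv0, ?_, ?_, ?_, ?_, ?_, hmemk⟩
  · -- `0 < D`
    rw [hD]
    have : 0 < n₀.natAbs := Int.natAbs_pos.2 hv
    positivity
  · -- `M₂ ⊥ v'`
    intro u hu
    obtain ⟨u₀, hu₀, rfl⟩ := (hmem u).1 hu
    rw [hv', real_inner_smul_left, real_inner_smul_right, hperp u₀ hu₀, mul_zero, mul_zero]
  · -- Gram matrix of `M₂`
    intro u hu w hw
    obtain ⟨u₁, hu₁, rfl⟩ := (hmem u).1 hu
    obtain ⟨u₂, hu₂, rfl⟩ := (hmem w).1 hw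
    obtain ⟨n, hn⟩ := exists_int_eighteen_mul hsymm hval u₁ u₂
    refine ⟨n, ?_⟩
    have hn' : (18 : ℝ) * ((A u₁ u₂ : ℚ) : ℝ) = n := by exact_mod_cast hn
    rw [real_inner_smul_left, real_inner_smul_right, inner_of_ker hinner hu₁ u₂]
    linear_combination (a ^ 2 * ((A u₁ u₂ : ℚ) : ℝ)) * hDc + a ^ 2 * hn'
  · -- `D |v'|² ∈ h² ℤ`
    refine ⟨18 * n₀ ^ 2, ?_⟩
    rw [hv', norm_smul, mul_pow, Real.norm_eq_abs, sq_abs, hvv]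
    push_cast
    linear_combination (h ^ 2 * (n₀ : ℝ) ^ 2) * hDc
  · -- discreteness of `M₂ ⊕ ℤ v'`
    refine discreteTopology_of_le_norm _ (ρ := |c| * min r ‖(v : EuclideanSpace ℝ (Fin 3))‖)
      (by positivity) ?_
    intro x hx hx0
    obtain ⟨y, hy, w, hw, rfl⟩ := Submodule.mem_sup.1 hx
    obtain ⟨u₀, hu₀, rfl⟩ := (hmem y).1 hy
    obtain ⟨j, rfl⟩ := Submodule.mem_span_singleton.1 hw
    have horth : ⟪c • (u₀ : EuclideanSpace ℝ (Fin 3)), j • v'⟫ = 0 := by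
      rw [← Int.cast_smul_eq_zsmul ℝ j, hv', real_inner_smul_left, real_inner_smul_right,
        real_inner_smul_right, hperp u₀ hu₀, mul_zero, mul_zero, mul_zero]
    have hsq : ‖c • (u₀ : EuclideanSpace ℝ (Fin 3)) + j • v'‖ ^ 2 =
        c ^ 2 * ‖(u₀ : EuclideanSpace ℝ (Fin 3))‖ ^ 2 +
          (j : ℝ) ^ 2 * (c ^ 2 * ‖(v : EuclideanSpace ℝ (Fin 3))‖ ^ 2) := by
      rw [norm_add_sq_real, horth, ← Int.cast_smul_eq_zsmul ℝ j, hv', norm_smul, norm_smul,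
        norm_smul, Real.norm_eq_abs, Real.norm_eq_abs, mul_pow, mul_pow, mul_pow, sq_abs, sq_abs]
      ring
    have hmin0 : 0 ≤ min r ‖(v : EuclideanSpace ℝ (Fin 3))‖ := le_min hr.le (norm_nonneg _)
    rw [← pow_le_pow_iff_left₀ (by positivity) (norm_nonneg _) two_ne_zero, hsq, mul_pow, sq_abs]
    by_cases hu00 : u₀ = 0
    · -- purely vertical vector: `j ≠ 0`
      have hj : j ≠ 0 := by
        rintro rfl
        apply hx0
        rw [hu00, Submodule.coe_zero, smul_zero, zero_smul, add_zero]
      have hj1 : (1 : ℝ) ≤ (j : ℝ) ^ 2 := by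
        have : (1 : ℤ) ≤ j ^ 2 := by nlinarith [Int.one_le_abs hj, sq_abs j]
        exact_mod_cast this
      have h1 :
          (min r ‖(v : EuclideanSpace ℝ (Fin 3))‖) ^ 2 ≤ ‖(v : EuclideanSpace ℝ (Fin 3))‖ ^ 2 :=
        pow_le_pow_left₀ hmin0 (min_le_right _ _) 2
      have h2 : 0 ≤ c ^ 2 * ‖(u₀ : EuclideanSpace ℝ (Fin 3))‖ ^ 2 := by positivity
      nlinarith [sq_nonneg c, mul_nonneg (sq_nonneg c) (sq_nonneg ‖(v : EuclideanSpace ℝ (Fin 3))‖)]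
    · -- non-zero in-layer part
      have hu0' : (u₀ : EuclideanSpace ℝ (Fin 3)) ≠ 0 := fun h0 => hu00 (by exact_mod_cast h0)
      have h1 : r ≤ ‖(u₀ : EuclideanSpace ℝ (Fin 3))‖ := hrN _ u₀.2 hu0'
      have h2 :
          (min r ‖(v : EuclideanSpace ℝ (Fin 3))‖) ^ 2 ≤ ‖(u₀ : EuclideanSpace ℝ (Fin 3))‖ ^ 2 :=
        pow_le_pow_left₀ hmin0 ((min_le_left _ _).trans h1) 2
      have h3 : 0 ≤ (j : ℝ) ^ 2 * (c ^ 2 * ‖(v : EuclideanSpace ℝ (Fin 3))‖ ^ 2) := by positivity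
      nlinarith [sq_nonneg c]
  · -- full rank
    have hle : (N : Set (EuclideanSpace ℝ (Fin 3))) ⊆
        (M₂ ⊔ Submodule.span ℤ {v'} : Submodule ℤ (EuclideanSpace ℝ (Fin 3))) :=
      fun z hz => hmemk z (N.smul_mem _ hz)
    rw [eq_top_iff, ← hNs]
    exact Submodule.span_le.2 fun z hz => Submodule.subset_span (hle hz)

end HcpRigiditySplit

/-- **STUB B2c₁ᵦ — template lattices are split.** For the hcp template with `h²/a² ∉ ℚ`, let
`N ⊆ ℝ³` be a discrete `ℤ`-module spanning `ℝ³` all of whose vectors have template lengths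
`‖z‖ = dist a' b'` (`a', b'` template points).  Then for every `k ≥ 1` there are a `ℤ`-module
`M₂ ⊥ v` with `D⟨u,w⟩ ∈ a²ℤ` on `M₂`, `D|v|² ∈ h²ℤ`, `M₂ ⊕ ℤv` discrete and spanning `ℝ³`, and
`(1/k) N ⊆ M₂ ⊕ ℤv`.  (The Gram pencil `a² A + h² λ ⊗ λ` of `N` — the `h²`-part is the square of
the layer index because its diagonal values `m²` are squares — has a vertical period by the 2-adic
structure of the in-layer values `(I² + IJ + J²)/9`.) [folklore] -/
theorem stub_templateLatticeSplit : ∀ (a h : ℝ) (ha : a ≠ 0) (hh : h ≠ 0), ¬ (∃ q : ℚ, h ^ 2 = (q : ℝ) * a ^ 2) → ∀ N : Submodule ℤ (EuclideanSpace ℝ (Fin 3)), DiscreteTopology N → Submodule.span ℝ (N : Set (EuclideanSpace ℝ (Fin 3))) = ⊤ → (∀ z ∈ N, ∃ a' ∈ (Literature.MathematicalPhysics.StatisticalMechanics.hcpPeriodicConfiguration ha hh).points, ∃ b' ∈ (Literature.MathematicalPhysics.StatisticalMechanics.hcpPeriodicConfiguration ha hh).points, ‖z‖ = dist a' b') → ∀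 k : ℕ, 0 < k → ∃ (M₂ : Submodule ℤ (EuclideanSpace ℝ (Fin 3))) (v : EuclideanSpace ℝ (Fin 3)) (D : ℕ), 0 < D ∧ v ≠ 0 ∧ (∀ u ∈ M₂, inner ℝ u v = 0) ∧ (∀ u ∈ M₂, ∀ w ∈ M₂, ∃ n : ℤ, (D : ℝ) * inner ℝ u w = (n : ℝ) * a ^ 2) ∧ (∃ n : ℤ, (D : ℝ) * ‖v‖ ^ 2 = (n : ℝ) * h ^ 2) ∧ DiscreteTopology ↥(M₂ ⊔ Submodule.span ℤ {v}) ∧ Submodule.span ℝ ((M₂ ⊔ Submodule.span ℤ {v} : Submodule ℤ (EuclideanSpace ℝ (Fin 3))) : Set (EuclideanSpace ℝ (Fin 3))) = ⊤ ∧ ∀ p : EuclideanSpace ℝ (Fin 3), (k : ℤ) • p ∈ N → p ∈ M₂ ⊔ Submodule.span ℤ {v} :=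
  fun _ _ ha hh hq _ hNd hNs hN _ hk =>
    HcpRigiditySplit.templateLatticeSplit ha hh hq hNd hNs hN hk

end Summit.AtomisticToContinuum.Crystallization.Theorems
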